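import Summits.CriticalPhenomena.SAWScalingLimit.Theorems.SAWDefectDecoherenceBoundaryClosureRZigzagDiscretisationExitCorner
import Summits.CriticalPhenomena.SAWScalingLimit.Theorems.SAWDefectDecoherenceBoundaryClosureRZigzagDiscretisationDeep
import Summits.CriticalPhenomena.SAWScalingLimit.Theorems.SAWDefectDecoherenceBoundaryClosureRZigzagDiscretisationTube
import HarnessLib

/-!
# Crux `BoundaryClosureR` (stmt-CriticalPhenomena-14004), line `polygon-parity-squeeze`,
# stub `stub_innerPolygonsOfZigzag` (7b): the trimmed discretisation is connected

Landing target: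
`Summits/CriticalPhenomena/SAWScalingLimit/Theorems/SAWDefectDecoherenceBoundaryClosureRZigzagDiscretisationConnected.lean`
(`--supports stmt-CriticalPhenomena-14004`; building block of the registered stub
`stub_innerPolygonsOfZigzag`, the lattice half of the inner-polygon construction (IP)).

* `walk_reachable` — a lattice walk all of whose faces lie in a vertex set joins its ends there;
* `chain_reachable` — faces shadowing a chain of points with steps `≤ t` are joined inside any
  vertex set containing all faces within `4t + 22δ` of the chain points (the tube lemma, scaled);
* `eventually_preconnected` — **C1**: eventually `ℍ[Λ^P_δ]` is preconnected: every kept face walks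
  inward through kept faces to the `r/16`-thick interior of `P` (up-exits), where a uniform thick chain
  (`thick_uniform`) shadows a path of kept faces (deep faces are kept, K2).

Sources: folklore.  No proposition is defined and no named fact is introduced.
-/

noncomputable section

open scoped ComplexConjugate Topology
open Set Metric Filter
open Literature.Probability.LatticeModels Literature.Probability.RandomPlanarGeometry
  Literature.Probability.RandomPlanarGeometry.SAW

namespace Summit.CriticalPhenomena.SAWScalingLimit.Theorems.PolygonParitySqueeze.ZigzagDiscretisation

/-! ### 1. Walks and chains inside a vertex set -/

/-- **A lattice walk whose faces lie in `T` joins its ends in `ℍ[T]`.** [folklore] -/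
theorem walk_reachable {T : Set HexVertex} (j : Fin 6) (v : HexVertex) (n : ℕ) (hT : ∀ i ≤ n, zdWalk j v i ∈ T) :
    ∃ (h0 : v ∈ T) (hn : zdWalk j v n ∈ T), (hexGraph.induce T).Reachable ⟨v, h0⟩ ⟨zdWalk j v n, hn⟩ := by
  induction n with
  | zero => exact ⟨by simpa using hT 0 le_rfl, hT 0 le_rfl, by simp⟩
  | succ n ih =>
    obtain ⟨h0, hn, hr⟩ := ih fun i hi => hT i (by omega)
    exact ⟨h0, hT (n + 1) le_rfl, hr.trans (induce_reachable_of_adj hn (hT (n + 1) le_rfl) (zdWalk_adj j v n))⟩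

/-- **Faces shadowing a chain are joined inside a vertex set containing the tube of the chain.**
[folklore] -/
theorem chain_reachable {T : Set HexVertex} {δ t : ℝ} (hδ : 0 < δ) (ht : 0 ≤ t) (n : ℕ) (w : ℕ → ℂ) (g : ℕ → HexVertex)
    (hg : ∀ i ≤ n, dist ((δ : ℂ) * hexCenter (g i)) (w i) ≤ 2 * δ)
    (hw : ∀ i < n, dist (w i) (w (i + 1)) ≤ t)
    (hT : ∀ i ≤ n, ∀ u : HexVertex, dist ((δ : ℂ) * hexCenter u) (w i) ≤ 4 * t + 22 * δ → u ∈ T) :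
    ∃ (h0 : g 0 ∈ T) (hn : g n ∈ T), (hexGraph.induce T).Reachable ⟨g 0, h0⟩ ⟨g n, hn⟩ := by
  have hmem : ∀ i ≤ n, g i ∈ T := fun i hi => hT i hi (g i) (by linarith [hg i hi])
  have hds : ∀ u u' : HexVertex, dist ((δ : ℂ) * hexCenter u) ((δ : ℂ) * hexCenter u') = δ * dist (hexCenter u) (hexCenter u') :=
    fun u u' => by rw [dist_eq_norm, ← mul_sub, norm_mul, Complex.norm_real, Real.norm_of_nonneg hδ.le, ← dist_eq_norm]
  suffices key : ∀ (i : ℕ) (hi : i ≤ n), (hexGraph.induce T).Reachable ⟨g 0, hmem 0 (Nat.zero_le _)⟩ ⟨g i, hmem i hi⟩ from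
    ⟨hmem 0 (Nat.zero_le _), hmem n le_rfl, key n le_rfl⟩
  intro i hi
  induction i with
  | zero => rfl
  | succ i ih =>
    have hi' : i ≤ n := by omega
    refine (ih hi').trans ?_
    -- the tube between `g i` and `g (i+1)`
    set R : ℝ := t / δ + 4 with hR
    have hdist : dist (hexCenter (g i)) (hexCenter (g (i + 1))) ≤ R := by
      have h1 : dist ((δ : ℂ) * hexCenter (g i)) ((δ : ℂ) * hexCenter (g (i + 1))) ≤ t + 4 * δ := by
        calc dist ((δ : ℂ) * hexCenter (g i)) ((δ : ℂ) * hexCenter (g (i + 1)))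
            ≤ dist ((δ : ℂ) * hexCenter (g i)) (w i) + (dist (w i) (w (i + 1)) + dist (w (i + 1)) ((δ : ℂ) * hexCenter (g (i + 1)))) :=
              (dist_triangle _ _ _).trans (add_le_add le_rfl (dist_triangle _ _ _))
          _ ≤ 2 * δ + (t + 2 * δ) := by
              refine add_le_add (hg i hi') (add_le_add (hw i (by omega)) ?_)
              rw [dist_comm]; exact hg (i + 1) hi
          _ = t + 4 * δ := by ring
      rw [hds] at h1
      have h2 : dist (hexCenter (g i)) (hexCenter (g (i + 1))) ≤ (t + 4 * δ) / δ := by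
        rw [le_div_iff₀ hδ]; linarith
      have h3 : (t + 4 * δ) / δ = R := by rw [hR]; field_simp
      linarith
    obtain ⟨hv, hw', hreach⟩ := tube T (g i) (g (i + 1)) R hdist fun u hu => hT i hi' u (by
      have h1 : dist ((δ : ℂ) * hexCenter u) ((δ : ℂ) * hexCenter (g i)) ≤ δ * (4 * R + 4) := by
        rw [hds]; exact mul_le_mul_of_nonneg_left hu hδ.le
      have h2 : δ * (4 * R + 4) = 4 * t + 20 * δ := by rw [hR]; field_simp; ring
      calc dist ((δ : ℂ) * hexCenter u) (w i) ≤ dist ((δ : ℂ) * hexCenter u) ((δ : ℂ) * hexCenter (g i)) +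
            dist ((δ : ℂ) * hexCenter (g i)) (w i) := dist_triangle _ _ _
        _ ≤ (4 * t + 20 * δ) + 2 * δ := by rw [← h2]; exact add_le_add h1 (hg i hi')
        _ = 4 * t + 22 * δ := by ring)
    exact hreach

/-- **Two faces with nearby scaled centres are joined inside a vertex set containing all faces near
them.** [folklore] -/
theorem near_reachable {T : Set HexVertex} {δ s : ℝ} (hδ : 0 < δ) (hs : 0 ≤ s) (u w : HexVertex)
    (hd : dist ((δ : ℂ) * hexCenter u) ((δ : ℂ) * hexCenter w) ≤ s)
    (hT : ∀ y : HexVertex, dist ((δ : ℂ) * hexCenter y) ((δ : ℂ) * hexCenter u) ≤ 4 * s + 4 * δ → y ∈ T) :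
    ∃ (hu : u ∈ T) (hw : w ∈ T), (hexGraph.induce T).Reachable ⟨u, hu⟩ ⟨w, hw⟩ := by
  have hds : ∀ u u' : HexVertex, dist ((δ : ℂ) * hexCenter u) ((δ : ℂ) * hexCenter u') = δ * dist (hexCenter u) (hexCenter u') :=
    fun u u' => by rw [dist_eq_norm, ← mul_sub, norm_mul, Complex.norm_real, Real.norm_of_nonneg hδ.le, ← dist_eq_norm]
  refine tube T u w (s / δ) ?_ fun y hy => hT y ?_
  · rw [hds] at hd
    rwa [le_div_iff₀ hδ, mul_comm]
  · rw [hds]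
    have : δ * (4 * (s / δ) + 4) = 4 * s + 4 * δ := by field_simp
    rw [← this]
    exact mul_le_mul_of_nonneg_left hy hδ.le

/-! ### 2. C1: the trimmed discretisation is preconnected -/

section C1

variable {D P : DobrushinDomain} {Cor : Finset ℂ} {κ : ℂ → Fin 6 × Fin 6 × Bool}
  {r ρ r₁ r₀ : ℝ} {Λ : ℝ → Finset HexVertex} {m m₀ : ℝ → ℤ} {a b : ℝ → Sym2 HexVertex}

/-- **C1: eventually `ℍ[Λ^P_δ]` is preconnected.** [folklore] -/
theorem eventually_preconnected
    (hA : AdmissibleFamily D ρ Λ m b) (hP : PinnedFlatRoot D Λ b (D.pt 0) a r₀ m₀)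
    (hSD : P.carrier ⊆ D.carrier) (hr : 0 < r) (hrρ : r ≤ ρ / 16) (hrr₁ : r ≤ r₁ / 16) (hr₁r₀ : r₁ ≤ r₀)
    (hD0 : D.carrier ∩ ball (D.pt 0) r₁ = {z : ℂ | (D.pt 0).im < z.im} ∩ ball (D.pt 0) r₁)
    (hF : ∀ w ∈ frontier P.carrier, w ∉ ball (D.pt 1) (15 * ρ / 16) → w ∉ ball (D.pt 0) (15 * r₁ / 16) → w ∈ D.carrier)
    (hdist : ρ + r₁ ≤ dist (D.pt 0) (D.pt 1))
    (hCor : ∀ c ∈ Cor, c ∈ frontier P.carrier)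
    (hsep : ∀ c ∈ Cor, ∀ c' ∈ Cor, c ≠ c' → 4 * r ≤ dist c c')
    (hflat : ∀ z ∈ frontier P.carrier, (∀ c ∈ Cor, r ≤ dist z c) →
      ∃ k : Fin 6, P.carrier ∩ ball z (r / 2) = halfPlane k z ∩ ball z (r / 2))
    (Hκ : ∀ c ∈ Cor, ((κ c).2.2 = true ∧ P.carrier ∩ ball c (2 * r) = halfPlane (κ c).1 c ∩ halfPlane (κ c).2.1 c ∩ ball c (2 * r)) ∨
      ((κ c).2.2 = false ∧ P.carrier ∩ ball c (2 * r) = (halfPlane (κ c).1 c ∪ halfPlane (κ c).2.1 c) ∩ ball c (2 * r))) :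
    ∀ᶠ δ : ℝ in 𝓝[>] 0,
      (hexGraph.induce ((zdLam P.carrier Cor κ r (D.pt 1) (D.pt 0) ρ r₁ Λ m m₀ δ : Finset HexVertex) : Set HexVertex)).Preconnected := by
  set S := P.carrier with hS
  have hSc : Sᶜ.Nonempty := by
    by_contra h
    rw [not_nonempty_iff_eq_empty, compl_empty_iff] at h
    exact D.toJordanDomain.carrier_ne_univ (univ_subset_iff.1 (h ▸ hSD))
  -- the thick interior and its uniform chains
  set K : Set ℂ := {y : ℂ | r / 16 ≤ infDist y Sᶜ} with hK
  have hKS : K ⊆ S := fun y hy => ball_subset_of_le_infDist hy (mem_ball_self (by positivity))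
  have hKc : IsCompact K :=
    Metric.isCompact_of_isClosed_isBounded (isClosed_le continuous_const (continuous_infDist_pt _))
      ((D.isBounded.subset hSD).subset hKS)
  obtain ⟨t, ht, hchain⟩ := thick_uniform P.isOpen P.isConnected hSc hKc hKS
  have hK2 := eventually_mem_zdLam_of_deep (r₁ := r₁) hA hP P.isOpen hSD hr hCor hsep hflat Hκ
    (show 0 < min (2 * t) (r / 32) by positivity)
  have hupS := eventually_exit_up_side hA hP P.isOpen hSD hr hrρ hrr₁ hr₁r₀ hD0 hF hdist hCor hsep hflat Hκ
  have hupC := eventually_exit_up_corner hA hP P.isOpen hSD hr hrρ hrr₁ hr₁r₀ hD0 hF hdist hCor hsep hflat Hκ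
  have hδ1 : ∀ᶠ δ : ℝ in 𝓝[>] 0, δ ∈ Ioo (0 : ℝ) (min (t / 11) (r / 400)) := Ioo_mem_nhdsGT (by positivity)
  filter_upwards [hK2, hupS, hupC, hδ1] with δ hK2δ hupSδ hupCδ hδδ
  obtain ⟨hδ, hδm⟩ := hδδ
  have hδt : δ < t / 11 := hδm.trans_le (min_le_left _ _)
  have hδr : δ < r / 400 := hδm.trans_le (min_le_right _ _)
  set L := zdLam S Cor κ r (D.pt 1) (D.pt 0) ρ r₁ Λ m m₀ δ with hL
  -- Step 1: every kept face reaches a kept face of the thick interior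
  have exit : ∀ u ∈ L, ∃ (u' : HexVertex) (hu : u ∈ (L : Set HexVertex)) (hu' : u' ∈ (L : Set HexVertex)),
      (δ : ℂ) * hexCenter u' ∈ K ∧ (hexGraph.induce (L : Set HexVertex)).Reachable ⟨u, hu⟩ ⟨u', hu'⟩ := by
    intro u hu
    have hpS : (δ : ℂ) * hexCenter u ∈ S := mem_carrier_of_mem_zdLam hu
    obtain ⟨w, hwF, hwd⟩ := exists_frontier_of_mem P.isOpen hSc hpS
    by_cases hdeep : r / 16 ≤ infDist ((δ : ℂ) * hexCenter u) Sᶜ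
    · exact ⟨u, hu, hu, hdeep, SimpleGraph.Reachable.refl _⟩
    push Not at hdeep
    have hpw : (δ : ℂ) * hexCenter u ∈ ball w (r / 8) := by rw [mem_ball, hwd]; linarith
    by_cases hfar : ∀ c ∈ Cor, r ≤ dist w c
    · obtain ⟨k, hk⟩ := hflat w hwF hfar
      obtain ⟨n, hwalk, hend⟩ := hupSδ w hwF hfar k hk u hu hpw
      obtain ⟨h0, hn, hreach⟩ := walk_reachable (T := (L : Set HexVertex)) k u n fun i hi => hwalk i hi
      exact ⟨_, h0, hn, by rw [hK, mem_setOf_eq]; linarith, hreach⟩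
    · push Not at hfar
      obtain ⟨c, hc, hwc⟩ := hfar
      have hpc : (δ : ℂ) * hexCenter u ∈ ball c (9 * r / 8) := by
        rw [mem_ball]
        calc dist ((δ : ℂ) * hexCenter u) c ≤ dist ((δ : ℂ) * hexCenter u) w + dist w c := dist_triangle _ _ _
          _ < r / 8 + r := by gcongr; exact mem_ball.1 hpw
          _ = 9 * r / 8 := by ring
      obtain ⟨j, n, hwalk, hend⟩ := hupCδ c hc u hu hpc
      obtain ⟨h0, hn, hreach⟩ := walk_reachable (T := (L : Set HexVertex)) j u n fun i hi => hwalk i hi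
      exact ⟨_, h0, hn, hend, hreach⟩
  -- Step 2: two kept faces of the thick interior are joined
  have deep_mem : ∀ y : HexVertex, min (2 * t) (r / 32) ≤ infDist ((δ : ℂ) * hexCenter y) Sᶜ → y ∈ (L : Set HexVertex) :=
    fun y hy => hK2δ y hy
  have join : ∀ u₁ u₂ : HexVertex, (δ : ℂ) * hexCenter u₁ ∈ K → (δ : ℂ) * hexCenter u₂ ∈ K →
      ∀ (h₁ : u₁ ∈ (L : Set HexVertex)) (h₂ : u₂ ∈ (L : Set HexVertex)),
      (hexGraph.induce (L : Set HexVertex)).Reachable ⟨u₁, h₁⟩ ⟨u₂, h₂⟩ := by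
    intro u₁ u₂ hu₁ hu₂ h₁ h₂
    obtain ⟨n, w, hw0, hwn, hstep, hdepth⟩ := hchain _ hu₁ _ hu₂
    -- faces shadowing the chain
    have hg : ∀ i : ℕ, ∃ x : Site 2, dist (hexCenter ((x, 0) : HexVertex)) ((δ : ℂ)⁻¹ * w i) ≤ 2 := fun i =>
      exists_face_near _
    choose gx hgx using hg
    set g : ℕ → HexVertex := fun i => ((gx i, 0) : HexVertex) with hgdef
    have hgd : ∀ i ≤ n, dist ((δ : ℂ) * hexCenter (g i)) (w i) ≤ 2 * δ := by
      intro i _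
      have := hgx i
      have e : w i = (δ : ℂ) * ((δ : ℂ)⁻¹ * w i) := by
        rw [← mul_assoc, mul_inv_cancel₀ (by exact_mod_cast hδ.ne'), one_mul]
      rw [e, dist_eq_norm, ← mul_sub, norm_mul, Complex.norm_real, Real.norm_of_nonneg hδ.le, ← dist_eq_norm]
      nlinarith
    have htube : ∀ i ≤ n, ∀ y : HexVertex, dist ((δ : ℂ) * hexCenter y) (w i) ≤ 4 * t + 22 * δ → y ∈ (L : Set HexVertex) := by
      intro i hi y hy
      apply deep_mem
      have h1 := hdepth i hi
      have h2 := infDist_le_infDist_add_dist (x := w i) (y := (δ : ℂ) * hexCenter y) (s := Sᶜ)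
      rw [dist_comm] at hy
      have : 2 * t ≤ infDist ((δ : ℂ) * hexCenter y) Sᶜ := by linarith
      exact (min_le_left _ _).trans this
    obtain ⟨hg0, hgn, hmid⟩ := chain_reachable hδ ht.le n w g hgd hstep htube
    -- the two ends
    have endjoin : ∀ (u : HexVertex) (i : ℕ), (δ : ℂ) * hexCenter u ∈ K → i ≤ n → w i = (δ : ℂ) * hexCenter u →
        ∀ (hu : u ∈ (L : Set HexVertex)) (hgi : g i ∈ (L : Set HexVertex)),
        (hexGraph.induce (L : Set HexVertex)).Reachable ⟨u, hu⟩ ⟨g i, hgi⟩ := by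
      intro u i huK hi hwi hu hgi
      have hd : dist ((δ : ℂ) * hexCenter u) ((δ : ℂ) * hexCenter (g i)) ≤ 2 * δ := by
        rw [dist_comm, ← hwi]; exact hgd i hi
      obtain ⟨_, _, hreach⟩ := near_reachable (T := (L : Set HexVertex)) hδ (by positivity) u (g i) hd fun y hy => by
        apply deep_mem
        have h2 := infDist_le_infDist_add_dist (x := (δ : ℂ) * hexCenter u) (y := (δ : ℂ) * hexCenter y) (s := Sᶜ)
        rw [hK, mem_setOf_eq] at huK
        rw [dist_comm] at hy
        have : r / 32 ≤ infDist ((δ : ℂ) * hexCenter y) Sᶜ := by linarith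
        exact (min_le_right _ _).trans this
      exact hreach
    exact ((endjoin u₁ 0 hu₁ (Nat.zero_le _) hw0 h₁ hg0).trans hmid).trans (endjoin u₂ n hu₂ le_rfl hwn h₂ hgn).symm
  -- conclusion
  rintro ⟨v, hv⟩ ⟨v', hv'⟩
  obtain ⟨u, hvL, huL, huK, hvu⟩ := exit v hv
  obtain ⟨u', hv'L, hu'L, hu'K, hv'u'⟩ := exit v' hv'
  exact (hvu.trans (join u u' huK hu'K huL hu'L)).trans hv'u'.symm

end C1

/-- **A lattice walk inside a vertex set joins its ends** (registered form, sub-goal of `stub_innerPolygonsOfZigzag`). [folklore] -/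
theorem zd_walk_reachable : ∀ (T : Set HexVertex) (j : Fin 6) (v : HexVertex) (n : ℕ), (∀ i ≤ n, zdWalk j v i ∈ T) → ∃ (h0 : v ∈ T) (hn : zdWalk j v n ∈ T), (hexGraph.induce T).Reachable ⟨v, h0⟩ ⟨zdWalk j v n, hn⟩ :=
  fun _ j v n hT => walk_reachable j v n hT

end Summit.CriticalPhenomena.SAWScalingLimit.Theorems.PolygonParitySqueeze.ZigzagDiscretisation

end
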